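import Summits.CriticalPhenomena.CardyFormulaZ2.Theorems.StripClusterRates.Negative.SubmultiplicativeOne
import Summits.CriticalPhenomena.CardyFormulaZ2.Theorems.CardyBoundaryCoulombGasStripRatesExist

/-!
# Cardy order bounds transfer-matrix order from below for the two-cluster rate of `StripClusterRates`

Support file for line `two-cluster-rate-is-stationary-gap` (crux `StripClusterRates`,
stmt-CriticalPhenomena-13878), lead c5. The crux takes its limits in TRANSFER-MATRIX ORDER (`m → ∞` at fixed
width `n`, then `n → ∞`): `γ₂(n) = lim_m −log p₂(m,n)/m` and `n·γ₂(n) → 2π`. Cardy's prediction (1998,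
eq. (bb)) is printed in CARDY ORDER (scaling limit at fixed aspect ratio `A`, then `A → ∞`):
`−log lim_n p₂(A·n, n) ∼ 2π·A`. For ONE cluster the two orders were reconciled by lead −1's Fekete sandwich
(`stub_sandwichUpper` + `Negative.SubmultiplicativeOne`), which is how the γ₁-half became a corollary of crux 4.
For TWO clusters only one half of the sandwich is available in the tree, and this file lands exactly that half:

* §1 `pTwo_blocks_le`, `rateTwo_ge_finite : γ₂(n) ≥ −log p₂(m,n)/(m+1)` for EVERY `m` (from the landed
  sub-multiplicativity `StripRates.pTwo_submul`; the Negative work file had this as `rateTwo_ge_finite`,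
  never landed under `Theorems/`).
* §2 `nMul_rateTwo_limit_ge_of_cardyOrder`: if `−log p₂(A·n, n) → G` as `n → ∞` (ANY Cardy-order value at the
  integer aspect ratio `A ≥ 1`), then every limit `L₂` of `n·γ₂(n)` satisfies `G/A ≤ L₂`.
* §3 `nMul_rateTwo_limit_ge_of_cardyOrderKac`: if moreover `g(A)/A → c` along the integer aspect ratios
  (Cardy's (bb) for two clusters says `c = 2π`), then `c ≤ L₂` — the LIMINF HALF of the transfer
  "Cardy order ⇒ TM order" is free. The LIMSUP half (`L₂ ≤ c`) would need SUPER-multiplicativity of `p₂`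
  in `m` with an `n`-uniform constant (gluing of open–closed–open strip structures across blocks), which is
  the one RSW-level statement missing for `K₂ ⟺` "Cardy-order three-arm strip exponent `h_{1,5} = 2`".
* §4 Combined with the band construction (`…TwoClusterUpperWindow`, upper edge `3π` under the γ₁-half): not
  imported here to keep the files independent; see the crux notes.

No definitions; `pTwo`, `rateSeqTwo` are the abbreviations of `Negative.KacFromAboveFalse`.

References: [Cardy1998] eq. (bb); [Aizenman1997] Thm 3; M. Fekete (1923).
-/

noncomputable section

open MeasureTheory Filter Topology
open Literature.Probability.LatticeModels Literature.Probability.Percolation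

namespace Summit.CriticalPhenomena.CardyFormulaZ2.Cruxes.StripClusterRates.TwoClusterRateIsStationaryGap

open Summit.CriticalPhenomena.CardyFormulaZ2.Theorems.StripClusterRates.Negative
open Summit.CriticalPhenomena.CardyFormulaZ2.Theorems.StripRates (pTwo_submul)

/-! ## §1 Finite-length lower bounds on the two-cluster rate -/

/-- `p₂ > 0` at every positive width (`pTwo_ge`). [folklore] -/
theorem co_pTwo_pos {n : ℕ} (hn : 1 ≤ n) (m : ℕ) : 0 < pTwo m n :=
  lt_of_lt_of_le (by positivity) (pTwo_ge (m := m) hn)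

/-- Iterated sub-multiplicativity: `p₂(k(m+1)+m, n) ≤ p₂(m,n)^{k+1}`. [folklore] -/
theorem pTwo_blocks_le {n : ℕ} (hn : 1 ≤ n) (m k : ℕ) : pTwo (k * (m + 1) + m) n ≤ pTwo m n ^ (k + 1) := by
  induction k with
  | zero => simp
  | succ k ih =>
    have h := pTwo_submul (k * (m + 1) + m) m n
    have heq : k * (m + 1) + m + m + 1 = (k + 1) * (m + 1) + m := by ring
    rw [heq] at h
    calc pTwo ((k + 1) * (m + 1) + m) n ≤ pTwo (k * (m + 1) + m) n * pTwo m n := h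
      _ ≤ pTwo m n ^ (k + 1) * pTwo m n :=
          mul_le_mul_of_nonneg_right ih (co_pTwo_pos hn m).le
      _ = pTwo m n ^ (k + 1 + 1) := by ring

/-- **Finite-length lower bound on the two-cluster rate**: every limit `γ` of `−log p₂(m',n)/m'`
satisfies `γ ≥ −log p₂(m,n)/(m+1)` for EVERY `m` (`n ≥ 1`). [folklore] -/
theorem rateTwo_ge_finite {n : ℕ} (hn : 1 ≤ n) {γ : ℝ} (h : Tendsto (rateSeqTwo n) atTop (𝓝 γ)) (m : ℕ) :
    -Real.log (pTwo m n) / (m + 1) ≤ γ := by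
  have hlim := tendsto_blocks_ratio m (-Real.log (pTwo m n))
  refine le_of_tendsto_of_tendsto hlim (h.comp (tendsto_blocks m)) (Eventually.of_forall fun k ↦ ?_)
  have hp := co_pTwo_pos hn m
  have hpk := co_pTwo_pos hn (k * (m + 1) + m)
  have hlog : (k + 1 : ℝ) * -Real.log (pTwo m n) ≤ -Real.log (pTwo (k * (m + 1) + m) n) := by
    have := Real.log_le_log hpk (pTwo_blocks_le hn m k)
    rw [Real.log_pow] at this; push_cast at this; linarith
  show (k + 1 : ℝ) * -Real.log (pTwo m n) / ((k * (m + 1) + m : ℕ) : ℝ) ≤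
    -Real.log (pTwo (k * (m + 1) + m) n) / ((k * (m + 1) + m : ℕ) : ℝ)
  exact div_le_div_of_nonneg_right hlog (by positivity)

/-- The same bound multiplied through: `n·γ₂(n) ≥ n·(−log p₂(m,n))/(m+1)`. [folklore] -/
theorem nMul_rateTwo_ge_finite {n : ℕ} (hn : 1 ≤ n) {γ : ℝ} (h : Tendsto (rateSeqTwo n) atTop (𝓝 γ)) (m : ℕ) :
    (n : ℝ) * (-Real.log (pTwo m n) / (m + 1)) ≤ (n : ℝ) * γ :=
  mul_le_mul_of_nonneg_left (rateTwo_ge_finite hn h m) (by positivity)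

/-! ## §2 A Cardy-order value at aspect ratio `A` bounds every TM-order limit from below -/

/-- `n/(A·n+1) → 1/A`. [folklore] -/
theorem co_tendsto_div_aspect {A : ℕ} (hA : 1 ≤ A) :
    Tendsto (fun n : ℕ ↦ (n : ℝ) / ((A : ℝ) * n + 1)) atTop (𝓝 (1 / (A : ℝ))) := by
  have hA' : (0 : ℝ) < A := by exact_mod_cast hA
  have h : Tendsto (fun n : ℕ ↦ 1 / ((A : ℝ) + 1 / (n : ℝ))) atTop (𝓝 (1 / ((A : ℝ) + 0))) := by
    refine tendsto_const_nhds.div (tendsto_const_nhds.add ?_) (by positivity)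
    exact tendsto_const_nhds.div_atTop tendsto_natCast_atTop_atTop
  rw [add_zero] at h
  refine h.congr' ?_
  filter_upwards [eventually_ge_atTop 1] with n hn
  have : (n : ℝ) ≠ 0 := by exact_mod_cast Nat.one_le_iff_ne_zero.mp hn
  field_simp

/-- **Cardy order bounds TM order from below.** Let `γ₂(n)` be two-cluster rates as in the crux
(`n ≥ 1`) and `L₂` a limit of `n·γ₂(n)`. If at some integer aspect ratio `A ≥ 1` the Cardy-order
quantity `−log p₂(A·n, n)` converges to `G` as `n → ∞`, then `G/A ≤ L₂`
(`n·γ₂(n) ≥ n·(−log p₂(An,n))/(An+1) → G/A`). [cite: Cardy1998, eq. (bb)] -/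
theorem nMul_rateTwo_limit_ge_of_cardyOrder {γ₂ : ℕ → ℝ}
    (h₂ : ∀ n : ℕ, 1 ≤ n → Tendsto (rateSeqTwo n) atTop (𝓝 (γ₂ n)))
    {A : ℕ} (hA : 1 ≤ A) {G : ℝ} (hG : Tendsto (fun n : ℕ ↦ -Real.log (pTwo (A * n) n)) atTop (𝓝 G))
    {L₂ : ℝ} (hL : Tendsto (fun n : ℕ ↦ (n : ℝ) * γ₂ n) atTop (𝓝 L₂)) : G / A ≤ L₂ := by
  have hcmp : Tendsto (fun n : ℕ ↦ -Real.log (pTwo (A * n) n) * ((n : ℝ) / ((A : ℝ) * n + 1))) atTop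
      (𝓝 (G * (1 / (A : ℝ)))) := hG.mul (co_tendsto_div_aspect hA)
  rw [mul_one_div] at hcmp
  refine le_of_tendsto_of_tendsto hcmp hL ?_
  filter_upwards [eventually_ge_atTop 1] with n hn
  have h := nMul_rateTwo_ge_finite hn (h₂ n hn) (A * n)
  have hden : ((A * n : ℕ) : ℝ) + 1 = (A : ℝ) * n + 1 := by push_cast; ring
  rw [hden] at h
  calc -Real.log (pTwo (A * n) n) * ((n : ℝ) / ((A : ℝ) * n + 1))
      = (n : ℝ) * (-Real.log (pTwo (A * n) n) / ((A : ℝ) * n + 1)) := by ring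
    _ ≤ (n : ℝ) * γ₂ n := h

/-! ## §3 Cardy's two-cluster prediction in Cardy order gives the liminf half of K₂ -/

/-- **The liminf half of the transfer.** If for every integer aspect ratio `A ≥ 1` the Cardy-order
quantity `−log p₂(A·n, n)` converges (to `g(A)`, say) and `g(A)/A → c` as `A → ∞` (Cardy 1998, eq. (bb)
for two clusters: `c = 2π = π·h_{1,5}`), then every limit `L₂` of `n·γ₂(n)` satisfies `c ≤ L₂`. The
converse inequality `L₂ ≤ c` is NOT available by this argument (it needs super-multiplicativity of `p₂`
in the length with a width-uniform constant). [cite: Cardy1998, eq. (bb)] -/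
theorem nMul_rateTwo_limit_ge_of_cardyOrderKac {γ₂ : ℕ → ℝ}
    (h₂ : ∀ n : ℕ, 1 ≤ n → Tendsto (rateSeqTwo n) atTop (𝓝 (γ₂ n)))
    {g : ℕ → ℝ} (hg : ∀ A : ℕ, 1 ≤ A → Tendsto (fun n : ℕ ↦ -Real.log (pTwo (A * n) n)) atTop (𝓝 (g A)))
    {c : ℝ} (hc : Tendsto (fun A : ℕ ↦ g A / A) atTop (𝓝 c))
    {L₂ : ℝ} (hL : Tendsto (fun n : ℕ ↦ (n : ℝ) * γ₂ n) atTop (𝓝 L₂)) : c ≤ L₂ := by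
  refine le_of_tendsto hc ?_
  filter_upwards [eventually_ge_atTop 1] with A hA
  exact nMul_rateTwo_limit_ge_of_cardyOrder h₂ hA (hg A hA) hL

/-- **Registered form** (sub-goal `cardyOrder_liminf_transfer` of stmt-CriticalPhenomena-13878, lead c5; the
crux's two-cluster event inlined): Cardy-order convergence of `−log p₂(A·n, n)` to `g(A)` at every integer
aspect ratio `A ≥ 1` together with `g(A)/A → c` forces `c ≤ L₂` for every limit `L₂` of `n·γ₂(n)`
(= `nMul_rateTwo_limit_ge_of_cardyOrderKac`). [cite: Cardy1998, eq. (bb)] -/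
theorem cardyOrder_liminf_transfer : ∀ γ₂ : ℕ → ℝ, (∀ n : ℕ, 1 ≤ n → Tendsto (fun m : ℕ ↦ -Real.log ((bondPercolation (zdGraph 2) half).real {ω | ∃ x₁ ∈ (leftSide m n : Set (Site 2)), ∃ y₁ ∈ (rightSide m n : Set (Site 2)), ∃ x₂ ∈ (leftSide m n : Set (Site 2)), ∃ y₂ ∈ (rightSide m n : Set (Site 2)), ω ∈ openConnIn (rectangle m n : Set (Site 2)) x₁ y₁ ∧ ω ∈ openConnIn (rectangle m n : Set (Site 2)) x₂ y₂ ∧ ω ∉ openConnIn (rectangle m n : Set (Site 2)) x₁ x₂}) / (m : ℝ)) atTop (𝓝 (γ₂ n))) → ∀ g : ℕ → ℝ, (∀ A : ℕ, 1 ≤ A → Tendsto (fun n : ℕ ↦ -Real.log ((bondPercolation (zdGraph 2) half).real {ω | ∃ x₁ ∈ (leftSide (A * n) n : Set (Site 2)), ∃ y₁ ∈ (rightSide (A * n) n : Set (Site 2)), ∃ x₂ ∈ (leftSide (A * n) n : Set (Site 2)), ∃ y₂ ∈ (rightSide (A * n) n : Set (Site 2)), ω ∈ openConnIn (rectangle (A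 * n) n : Set (Site 2)) x₁ y₁ ∧ ω ∈ openConnIn (rectangle (A * n) n : Set (Site 2)) x₂ y₂ ∧ ω ∉ openConnIn (rectangle (A * n) n : Set (Site 2)) x₁ x₂})) atTop (𝓝 (g A))) → ∀ c : ℝ, Tendsto (fun A : ℕ ↦ g A / A) atTop (𝓝 c) → ∀ L₂ : ℝ, Tendsto (fun n : ℕ ↦ (n : ℝ) * γ₂ n) atTop (𝓝 L₂) → c ≤ L₂ :=
  fun _ h₂ _ hg _ hc _ hL => nMul_rateTwo_limit_ge_of_cardyOrderKac h₂ hg hc hL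

end Summit.CriticalPhenomena.CardyFormulaZ2.Cruxes.StripClusterRates.TwoClusterRateIsStationaryGap

end
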